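import Summits.CriticalPhenomena.PercolationContinuityZ3.Theorems.PercNearOneGluingNoHeavyLowerTailSahiH4PlusDefs
import Summits.CriticalPhenomena.PercolationContinuityZ3.Theorems.PercNearOneGluingNoHeavyLowerTailSahiE4UnionThreeLattice
import Summits.CriticalPhenomena.PercolationContinuityZ3.Theorems.PercNearOneGluingNoHeavyLowerTailSahiE3ProdRow03UnionLattice
import Summits.CriticalPhenomena.PercolationContinuityZ3.Theorems.PercNearOneGluingNoHeavyLowerTailSahiE3ProductRowUnionLattice
import Summits.CriticalPhenomena.PercolationContinuityZ3.Theorems.PercNearOneGluingNoHeavyLowerTailSahiE3UnionTensorLattice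
import Summits.CriticalPhenomena.PercolationContinuityZ3.Theorems.PercNearOneGluingNoHeavyLowerTailSahiPAProduct
import Literature.Combinatorics.Sahi2008.Symmetry
import Summits.CriticalPhenomena.PercolationContinuityZ3.Theorems.PercNearOneGluingNoHeavyLowerTailSahiE4UnionPairBlock
import Mathlib.Tactic.FinCases
import HarnessLib

/-!
# `NoHeavyLowerTail` (crux stmt-CriticalPhenomena-4575), Sahi programme P4 — ★ `H₄⁺` IS CLOSED UNDER THE MEMBER-WISE OR WITH AN INDEPENDENT
# THREE-MEMBER BLOCK (lattice level; the `|K| ≤ 3` part of the closure programme in one statement)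

Support file (cell `prim-l12`, seat P4, generation 38; `--supports stmt-CriticalPhenomena-4575`).  No definitions, no named facts, no sorries;
standard axioms.

SETTING. `γ`, `β` finite preorders; probability weights `μ` on `γ` (Sahi-positive of order 2 = positively associated) and `ν` on `β`
(Sahi-positive of order 3); `a : Fin 4 → γ → [0,1]` and `b : Fin 4 → β → [0,1]` monotone with `b₃ = 0` (the block feeds the members `0,1,2` only);
`u_i(x,y) = a_i(x) + b_i(y) − a_i(x)b_i(y)` on `γ × β` with the product weight and the componentwise order.
THEOREM `h4Plus_orThree`: `H4Plus μ a → H4Plus (μ ⊗ ν) u`.  The eleven conclusions are the landed rungs: `E₄(u)` = `…SahiE4UnionThreeLattice`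
(generation 37); the product rows with the pair inside the block = `…SahiE3ProductRowUnionLattice` (rung `K = {0,1,2}`, generation 34) and with the
pair `{i,3}` = `…SahiE3ProdRow03UnionLattice` (generation 38), each relabelled within the block; the `E₃` rows of the sub-triples =
`…SahiE3UnionTensorLattice` (generation 32).  With `SahiPAProduct.sahiPositive_two_prodWeight` (the product weight is again positively
associated) and `or_mem_unitInterval`/`or_monotone` below, the theorem ITERATES: every read-once union of independent Sahi-3-positive monotone
blocks, each feeding at most three of the four members (after relabelling so that the unfed member is `3`), satisfies `H₄⁺`, in particular
`E₄ ≥ 0`; `h4Plus_orBlock` is the same statement with the unfed member `m` arbitrary (relabelling lemmas `h4Plus_swap03/13/23`).  HONEST FRAMING: a closure statement; the four-member block (all of `u₀,…,u₃` fed by one block) is NOT covered and is the open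
`|K| = 4` step; nothing here is Sahi's conjecture `C₄` itself. [this work]
-/

noncomputable section

namespace Summit.CriticalPhenomena.PercolationContinuityZ3.Theorems.SahiH4Plus

open Finset Function Literature.Combinatorics.Sahi2008
open Summit.CriticalPhenomena.PercolationContinuityZ3.Theorems.SahiE4UnionThree (sahiE_four_orThree_nonneg_of_sahiPositive)
open Summit.CriticalPhenomena.PercolationContinuityZ3.Theorems.SahiE3ProdRow03Union (sahiE_three_prodRow03_orThree_nonneg_of_sahiPositive)
open Summit.CriticalPhenomena.PercolationContinuityZ3.Theorems.SahiE3ProductRowUnion (sahiE_three_prodRow_orK012_nonneg_of_sahiPositive_two)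
open Summit.CriticalPhenomena.PercolationContinuityZ3.Theorems.SahiE3UnionTensor (sahiE_three_por_nonneg_of_sahiPositive_two)
open Summit.CriticalPhenomena.PercolationContinuityZ3.Theorems.SahiE4UnionPairBlock (sahiE_three_swap01 sahiE_three_swap12)

section symm
variable {α : Type*} [Fintype α]

/-- `E₄` is symmetric: relabelling `(1,0,2,3)`. [folklore] -/
theorem sahiE_four_perm1023 (μ : α → ℝ) (a : Fin 4 → α → ℝ) : sahiE μ 4 ![a 1, a 0, a 2, a 3] = sahiE μ 4 a := by
  have h := sahiE_comp_perm μ 4 (Equiv.swap 0 1) a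
  have e : (fun i => a ((Equiv.swap (0 : Fin 4) 1) i)) = ![a 1, a 0, a 2, a 3] := by
    funext i; fin_cases i <;> rfl
  rw [e] at h; exact h

/-- `E₄` is symmetric: relabelling `(2,0,1,3)`. [folklore] -/
theorem sahiE_four_perm2013 (μ : α → ℝ) (a : Fin 4 → α → ℝ) : sahiE μ 4 ![a 2, a 0, a 1, a 3] = sahiE μ 4 a := by
  have h := sahiE_comp_perm μ 4 ((Equiv.swap 0 2).trans (Equiv.swap 0 1)) a
  have e : (fun i => a (((Equiv.swap (0 : Fin 4) 2).trans (Equiv.swap 0 1)) i)) = ![a 2, a 0, a 1, a 3] := by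
    funext i; fin_cases i <;> rfl
  rw [e] at h; exact h

end symm

variable {γ β : Type*} [Fintype γ] [Fintype β] [Preorder γ] [Preorder β]

omit [Fintype γ] [Fintype β] [Preorder γ] [Preorder β] in
/-- The member-wise OR `u_i = a_i ⊕ b_i` of `[0,1]`-valued families is `[0,1]`-valued. [folklore] -/
theorem or_mem_unitInterval (a : Fin 4 → γ → ℝ) (b : Fin 4 → β → ℝ) (ha0 : ∀ i t, 0 ≤ a i t) (ha1 : ∀ i t, a i t ≤ 1)
    (hb0 : ∀ i t, 0 ≤ b i t) (hb1 : ∀ i t, b i t ≤ 1) (i : Fin 4) (p : γ × β) :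
    0 ≤ a i p.1 + b i p.2 - a i p.1 * b i p.2 ∧ a i p.1 + b i p.2 - a i p.1 * b i p.2 ≤ 1 := by
  have h1 := ha0 i p.1; have h2 := ha1 i p.1; have h3 := hb0 i p.2; have h4 := hb1 i p.2
  constructor <;> nlinarith [mul_nonneg (sub_nonneg.2 h2) (sub_nonneg.2 h4), mul_nonneg h1 h3]

omit [Fintype γ] [Fintype β] in
/-- The member-wise OR of monotone `[0,1]`-valued families is monotone for the componentwise order. [folklore] -/
theorem or_monotone (a : Fin 4 → γ → ℝ) (b : Fin 4 → β → ℝ) (ha1 : ∀ i t, a i t ≤ 1) (ham : ∀ i, Monotone (a i))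
    (hb1 : ∀ i t, b i t ≤ 1) (hbm : ∀ i, Monotone (b i)) (i : Fin 4) :
    Monotone (fun p : γ × β => a i p.1 + b i p.2 - a i p.1 * b i p.2) := by
  intro p q hpq
  have hx : a i p.1 ≤ a i q.1 := ham i hpq.1
  have hy : b i p.2 ≤ b i q.2 := hbm i hpq.2
  have e : (a i q.1 + b i q.2 - a i q.1 * b i q.2) - (a i p.1 + b i p.2 - a i p.1 * b i p.2)
      = (a i q.1 - a i p.1) * (1 - b i q.2) + (1 - a i p.1) * (b i q.2 - b i p.2) := by ring
  nlinarith [mul_nonneg (sub_nonneg.2 hx) (sub_nonneg.2 (hb1 i q.2)), mul_nonneg (sub_nonneg.2 (ha1 i p.1)) (sub_nonneg.2 hy)]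

/-- **`H₄⁺` is closed under the OR with an independent three-member block** (lattice level).  See the module docstring. [this work] -/
theorem h4Plus_orThree (μ : γ → ℝ) (ν : β → ℝ)
    (hμ0 : ∀ t, 0 ≤ μ t) (hμ1 : ∑ t, μ t = 1) (hν0 : ∀ t, 0 ≤ ν t) (hν1 : ∑ t, ν t = 1) (hμ2 : SahiPositive μ 2) (hν3 : SahiPositive ν 3)
    (a : Fin 4 → γ → ℝ) (b : Fin 4 → β → ℝ) (ha0 : ∀ i t, 0 ≤ a i t) (ha1 : ∀ i t, a i t ≤ 1) (ham : ∀ i, Monotone (a i))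
    (hb0 : ∀ i t, 0 ≤ b i t) (hb1 : ∀ i t, b i t ≤ 1) (hbm : ∀ i, Monotone (b i)) (hbz3 : ∀ t, b 3 t = 0)
    (h : H4Plus μ a) :
    H4Plus (fun p : γ × β => μ p.1 * ν p.2) (fun (i : Fin 4) (p : γ × β) => a i p.1 + b i p.2 - a i p.1 * b i p.2) := by
  have hν2 : SahiPositive ν 2 := SahiPositive.of_succ hν0 hν1 hν3
  -- E₃ of the block's sub-triples from Sahi-3-positivity
  have hb3 : ∀ (i j k : Fin 4), 0 ≤ sahiE ν 3 ![b i, b j, b k] := fun i j k =>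
    hν3 _ (fun l t => by fin_cases l <;> exact hb0 _ t) (fun l => by fin_cases l <;> exact hbm _)
  refine ⟨?_, ?_, ?_, ?_, ?_, ?_, ?_, ?_, ?_, ?_, ?_⟩
  -- e3_012
  · have h3 := sahiE_three_por_nonneg_of_sahiPositive_two μ ν hμ0 hμ1 hν0 hν1 hμ2 hν2 ![a 0, a 1, a 2] ![b 0, b 1, b 2]
      (fun i t => by fin_cases i <;> exact ha0 _ t) (fun i t => by fin_cases i <;> exact ha1 _ t) (fun i => by fin_cases i <;> exact ham _)
      (fun i t => by fin_cases i <;> exact hb0 _ t) (fun i t => by fin_cases i <;> exact hb1 _ t) (fun i => by fin_cases i <;> exact hbm _)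
      h.e3_012 (hb3 0 1 2)
    have e : (fun (i : Fin 3) (p : γ × β) => (![a 0, a 1, a 2] : Fin 3 → γ → ℝ) i p.1 + (![b 0, b 1, b 2] : Fin 3 → β → ℝ) i p.2
        - (![a 0, a 1, a 2] : Fin 3 → γ → ℝ) i p.1 * (![b 0, b 1, b 2] : Fin 3 → β → ℝ) i p.2)
        = ![(fun (i : Fin 4) (p : γ × β) => a i p.1 + b i p.2 - a i p.1 * b i p.2) 0, (fun (i : Fin 4) (p : γ × β) => a i p.1 + b i p.2 - a i p.1 * b i p.2) 1, (fun (i : Fin 4) (p : γ × β) => a i p.1 + b i p.2 - a i p.1 * b i p.2) 2] := by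
      funext i p; fin_cases i <;> rfl
    rw [e] at h3; exact h3
  -- e3_013
  · have h3 := sahiE_three_por_nonneg_of_sahiPositive_two μ ν hμ0 hμ1 hν0 hν1 hμ2 hν2 ![a 0, a 1, a 3] ![b 0, b 1, b 3]
      (fun i t => by fin_cases i <;> exact ha0 _ t) (fun i t => by fin_cases i <;> exact ha1 _ t) (fun i => by fin_cases i <;> exact ham _)
      (fun i t => by fin_cases i <;> exact hb0 _ t) (fun i t => by fin_cases i <;> exact hb1 _ t) (fun i => by fin_cases i <;> exact hbm _)
      h.e3_013 (hb3 0 1 3)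
    have e : (fun (i : Fin 3) (p : γ × β) => (![a 0, a 1, a 3] : Fin 3 → γ → ℝ) i p.1 + (![b 0, b 1, b 3] : Fin 3 → β → ℝ) i p.2
        - (![a 0, a 1, a 3] : Fin 3 → γ → ℝ) i p.1 * (![b 0, b 1, b 3] : Fin 3 → β → ℝ) i p.2)
        = ![(fun (i : Fin 4) (p : γ × β) => a i p.1 + b i p.2 - a i p.1 * b i p.2) 0, (fun (i : Fin 4) (p : γ × β) => a i p.1 + b i p.2 - a i p.1 * b i p.2) 1, (fun (i : Fin 4) (p : γ × β) => a i p.1 + b i p.2 - a i p.1 * b i p.2) 3] := by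
      funext i p; fin_cases i <;> rfl
    rw [e] at h3; exact h3
  -- e3_023
  · have h3 := sahiE_three_por_nonneg_of_sahiPositive_two μ ν hμ0 hμ1 hν0 hν1 hμ2 hν2 ![a 0, a 2, a 3] ![b 0, b 2, b 3]
      (fun i t => by fin_cases i <;> exact ha0 _ t) (fun i t => by fin_cases i <;> exact ha1 _ t) (fun i => by fin_cases i <;> exact ham _)
      (fun i t => by fin_cases i <;> exact hb0 _ t) (fun i t => by fin_cases i <;> exact hb1 _ t) (fun i => by fin_cases i <;> exact hbm _)
      h.e3_023 (hb3 0 2 3)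
    have e : (fun (i : Fin 3) (p : γ × β) => (![a 0, a 2, a 3] : Fin 3 → γ → ℝ) i p.1 + (![b 0, b 2, b 3] : Fin 3 → β → ℝ) i p.2
        - (![a 0, a 2, a 3] : Fin 3 → γ → ℝ) i p.1 * (![b 0, b 2, b 3] : Fin 3 → β → ℝ) i p.2)
        = ![(fun (i : Fin 4) (p : γ × β) => a i p.1 + b i p.2 - a i p.1 * b i p.2) 0, (fun (i : Fin 4) (p : γ × β) => a i p.1 + b i p.2 - a i p.1 * b i p.2) 2, (fun (i : Fin 4) (p : γ × β) => a i p.1 + b i p.2 - a i p.1 * b i p.2) 3] := by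
      funext i p; fin_cases i <;> rfl
    rw [e] at h3; exact h3
  -- e3_123
  · have h3 := sahiE_three_por_nonneg_of_sahiPositive_two μ ν hμ0 hμ1 hν0 hν1 hμ2 hν2 ![a 1, a 2, a 3] ![b 1, b 2, b 3]
      (fun i t => by fin_cases i <;> exact ha0 _ t) (fun i t => by fin_cases i <;> exact ha1 _ t) (fun i => by fin_cases i <;> exact ham _)
      (fun i t => by fin_cases i <;> exact hb0 _ t) (fun i t => by fin_cases i <;> exact hb1 _ t) (fun i => by fin_cases i <;> exact hbm _)
      h.e3_123 (hb3 1 2 3)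
    have e : (fun (i : Fin 3) (p : γ × β) => (![a 1, a 2, a 3] : Fin 3 → γ → ℝ) i p.1 + (![b 1, b 2, b 3] : Fin 3 → β → ℝ) i p.2
        - (![a 1, a 2, a 3] : Fin 3 → γ → ℝ) i p.1 * (![b 1, b 2, b 3] : Fin 3 → β → ℝ) i p.2)
        = ![(fun (i : Fin 4) (p : γ × β) => a i p.1 + b i p.2 - a i p.1 * b i p.2) 1, (fun (i : Fin 4) (p : γ × β) => a i p.1 + b i p.2 - a i p.1 * b i p.2) 2, (fun (i : Fin 4) (p : γ × β) => a i p.1 + b i p.2 - a i p.1 * b i p.2) 3] := by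
      funext i p; fin_cases i <;> rfl
    rw [e] at h3; exact h3
  -- p3_01: rung K012 with the relabelling (0, 1, 2, 3)
  · exact sahiE_three_prodRow_orK012_nonneg_of_sahiPositive_two μ ν hμ0 hμ1 hν0 hν1 hμ2 hν2 a b ha0 ha1 ham hb0 hb1 hbm hbz3
      h.e3_023 h.e3_123 h.p3_01
  -- p3_02: rung K012 with the relabelling (0, 2, 1, 3)
  · exact sahiE_three_prodRow_orK012_nonneg_of_sahiPositive_two μ ν hμ0 hμ1 hν0 hν1 hμ2 hν2 ![a 0, a 2, a 1, a 3] ![b 0, b 2, b 1, b 3] (fun i t => by fin_cases i <;> exact ha0 _ t) (fun i t => by fin_cases i <;> exact ha1 _ t) (fun i => by fin_cases i <;> exact ham _) (fun i t => by fin_cases i <;> exact hb0 _ t) (fun i t => by fin_cases i <;> exact hb1 _ t) (fun i => by fin_cases i <;> exact hbm _) (by intro t; exact hbz3 t)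
      h.e3_013 (by show 0 ≤ sahiE μ 3 ![a 2, a 1, a 3]; rw [sahiE_three_swap01 μ (a 1) (a 2) (a 3)]; exact h.e3_123) h.p3_02
  -- p3_12: rung K012 with the relabelling (1, 2, 0, 3)
  · exact sahiE_three_prodRow_orK012_nonneg_of_sahiPositive_two μ ν hμ0 hμ1 hν0 hν1 hμ2 hν2 ![a 1, a 2, a 0, a 3] ![b 1, b 2, b 0, b 3] (fun i t => by fin_cases i <;> exact ha0 _ t) (fun i t => by fin_cases i <;> exact ha1 _ t) (fun i => by fin_cases i <;> exact ham _) (fun i t => by fin_cases i <;> exact hb0 _ t) (fun i t => by fin_cases i <;> exact hb1 _ t) (fun i => by fin_cases i <;> exact hbm _) (by intro t; exact hbz3 t)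
      (by show 0 ≤ sahiE μ 3 ![a 1, a 0, a 3]; rw [sahiE_three_swap01 μ (a 0) (a 1) (a 3)]; exact h.e3_013) (by show 0 ≤ sahiE μ 3 ![a 2, a 0, a 3]; rw [sahiE_three_swap01 μ (a 0) (a 2) (a 3)]; exact h.e3_023) h.p3_12
  -- p3_03: rung 03 with the relabelling (0, 1, 2, 3)
  · exact sahiE_three_prodRow03_orThree_nonneg_of_sahiPositive μ ν hμ0 hμ1 hν0 hν1 hμ2 hν3 a b ha0 ha1 ham hb0 hb1 hbm hbz3
      h.e3_012 h.e3_013 h.e3_023 h.e3_123 h.p3_01 h.p3_02 h.p3_12 h.p3_03 h.p3_13 h.p3_23 h.e4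
  -- p3_13: rung 03 with the relabelling (1, 0, 2, 3)
  · exact sahiE_three_prodRow03_orThree_nonneg_of_sahiPositive μ ν hμ0 hμ1 hν0 hν1 hμ2 hν3 ![a 1, a 0, a 2, a 3] ![b 1, b 0, b 2, b 3] (fun i t => by fin_cases i <;> exact ha0 _ t) (fun i t => by fin_cases i <;> exact ha1 _ t) (fun i => by fin_cases i <;> exact ham _) (fun i t => by fin_cases i <;> exact hb0 _ t) (fun i t => by fin_cases i <;> exact hb1 _ t) (fun i => by fin_cases i <;> exact hbm _) (by intro t; exact hbz3 t)
      (by show 0 ≤ sahiE μ 3 ![a 1, a 0, a 2]; rw [sahiE_three_swap01 μ (a 0) (a 1) (a 2)]; exact h.e3_012) (by show 0 ≤ sahiE μ 3 ![a 1, a 0, a 3]; rw [sahiE_three_swap01 μ (a 0) (a 1) (a 3)]; exact h.e3_013) h.e3_123 h.e3_023 (by show 0 ≤ sahiE μ 3 ![a 1 * a 0, a 2, a 3]; rw [show a 1 * a 0 = a 0 * a 1 from mul_comm _ _]; exact h.p3_01) h.p3_12 h.p3_02 h.p3_13 h.p3_03 (by show 0 ≤ sahiE μ 3 ![a 2 *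 a 3, a 1, a 0]; rw [sahiE_three_swap12 μ (a 2 * a 3) (a 0) (a 1)]; exact h.p3_23) (by show 0 ≤ sahiE μ 4 ![a 1, a 0, a 2, a 3]; rw [sahiE_four_perm1023]; exact h.e4)
  -- p3_23: rung 03 with the relabelling (2, 0, 1, 3)
  · exact sahiE_three_prodRow03_orThree_nonneg_of_sahiPositive μ ν hμ0 hμ1 hν0 hν1 hμ2 hν3 ![a 2, a 0, a 1, a 3] ![b 2, b 0, b 1, b 3] (fun i t => by fin_cases i <;> exact ha0 _ t) (fun i t => by fin_cases i <;> exact ha1 _ t) (fun i => by fin_cases i <;> exact ham _) (fun i t => by fin_cases i <;> exact hb0 _ t) (fun i t => by fin_cases i <;> exact hb1 _ t) (fun i => by fin_cases i <;> exact hbm _) (by intro t; exact hbz3 t)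
      (by show 0 ≤ sahiE μ 3 ![a 2, a 0, a 1]; rw [sahiE_three_swap01 μ (a 0) (a 2) (a 1), sahiE_three_swap12 μ (a 0) (a 1) (a 2)]; exact h.e3_012) (by show 0 ≤ sahiE μ 3 ![a 2, a 0, a 3]; rw [sahiE_three_swap01 μ (a 0) (a 2) (a 3)]; exact h.e3_023) (by show 0 ≤ sahiE μ 3 ![a 2, a 1, a 3]; rw [sahiE_three_swap01 μ (a 1) (a 2) (a 3)]; exact h.e3_123) h.e3_013 (by show 0 ≤ sahiE μ 3 ![a 2 * a 0, a 1, a 3]; rw [show a 2 * a 0 = a 0 * a 2 from mul_comm _ _]; exact h.p3_02) (by show 0 ≤ sahiE μ 3 ![a 2 * a 1, a 0, a 3]; rw [show a 2 * a 1 = a 1 * a 2 from mul_comm _ _]; exact h.p3_12) h.p3_01 h.p3_23 (by show 0 ≤ sahiE μ 3 ![a 0 * a 3, a 2, a 1]; rw [sahiE_three_swap12 μ (a 0 * a 3) (a 1) (a 2)]; exact h.p3_03) (by show 0 ≤ sahiE μ 3 ![a 1 * a 3, a 2, a 0]; rw [sahiE_three_swap12 μ (a 1 * a 3) (a 0) (a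 2)]; exact h.p3_13) (by show 0 ≤ sahiE μ 4 ![a 2, a 0, a 1, a 3]; rw [sahiE_four_perm2013]; exact h.e4)
  -- e4
  · exact sahiE_four_orThree_nonneg_of_sahiPositive μ ν hμ0 hμ1 hν0 hν1 hμ2 hν3 a b ha0 ha1 ham hb0 hb1 hbm hbz3
      h.e3_012 h.e3_013 h.e3_023 h.e3_123 h.p3_01 h.p3_02 h.p3_12 h.p3_03 h.p3_13 h.p3_23 h.e4

section symm2
variable {α : Type*} [Fintype α]

/-- `E₄` is symmetric: relabelling by the transposition `(0 3)`. [folklore] -/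
theorem sahiE_four_swap03 (μ : α → ℝ) (a : Fin 4 → α → ℝ) : sahiE μ 4 ![a 3, a 1, a 2, a 0] = sahiE μ 4 a := by
  have h := sahiE_comp_perm μ 4 (Equiv.swap 0 3) a
  have e : (fun i => a (((Equiv.swap (0 : Fin 4) 3)) i)) = ![a 3, a 1, a 2, a 0] := by
    funext i; fin_cases i <;> rfl
  rw [e] at h; exact h

/-- `E₄` is symmetric: relabelling by the transposition `(1 3)`. [folklore] -/
theorem sahiE_four_swap13 (μ : α → ℝ) (a : Fin 4 → α → ℝ) : sahiE μ 4 ![a 0, a 3, a 2, a 1] = sahiE μ 4 a := by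
  have h := sahiE_comp_perm μ 4 (Equiv.swap 1 3) a
  have e : (fun i => a (((Equiv.swap (1 : Fin 4) 3)) i)) = ![a 0, a 3, a 2, a 1] := by
    funext i; fin_cases i <;> rfl
  rw [e] at h; exact h

/-- `E₄` is symmetric: relabelling by the transposition `(2 3)`. [folklore] -/
theorem sahiE_four_swap23 (μ : α → ℝ) (a : Fin 4 → α → ℝ) : sahiE μ 4 ![a 0, a 1, a 3, a 2] = sahiE μ 4 a := by
  have h := sahiE_comp_perm μ 4 (Equiv.swap 2 3) a
  have e : (fun i => a (((Equiv.swap (2 : Fin 4) 3)) i)) = ![a 0, a 1, a 3, a 2] := by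
    funext i; fin_cases i <;> rfl
  rw [e] at h; exact h

end symm2

omit [Preorder γ] in
/-- `H₄⁺` is invariant under relabelling the members by the transposition `(0 3)`. [this work] -/
theorem h4Plus_swap03 {μ : γ → ℝ} {a : Fin 4 → γ → ℝ} (h : H4Plus μ a) : H4Plus μ ![a 3, a 1, a 2, a 0] :=
  ⟨(by show 0 ≤ sahiE μ 3 ![a 3, a 1, a 2]; rw [sahiE_three_swap01 μ (a 1) (a 3) (a 2), sahiE_three_swap12 μ (a 1) (a 2) (a 3)]; exact h.e3_123),
   (by show 0 ≤ sahiE μ 3 ![a 3, a 1, a 0]; rw [sahiE_three_swap01 μ (a 1) (a 3) (a 0), sahiE_three_swap12 μ (a 1) (a 0) (a 3), sahiE_three_swap01 μ (a 0) (a 1) (a 3)]; exact h.e3_013),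
   (by show 0 ≤ sahiE μ 3 ![a 3, a 2, a 0]; rw [sahiE_three_swap01 μ (a 2) (a 3) (a 0), sahiE_three_swap12 μ (a 2) (a 0) (a 3), sahiE_three_swap01 μ (a 0) (a 2) (a 3)]; exact h.e3_023),
   (by show 0 ≤ sahiE μ 3 ![a 1, a 2, a 0]; rw [sahiE_three_swap12 μ (a 1) (a 0) (a 2), sahiE_three_swap01 μ (a 0) (a 1) (a 2)]; exact h.e3_012),
   (by show 0 ≤ sahiE μ 3 ![a 3 * a 1, a 2, a 0]; rw [show a 3 * a 1 = a 1 * a 3 from mul_comm _ _, sahiE_three_swap12 μ (a 1 * a 3) (a 0) (a 2)]; exact h.p3_13),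
   (by show 0 ≤ sahiE μ 3 ![a 3 * a 2, a 1, a 0]; rw [show a 3 * a 2 = a 2 * a 3 from mul_comm _ _, sahiE_three_swap12 μ (a 2 * a 3) (a 0) (a 1)]; exact h.p3_23),
   (by show 0 ≤ sahiE μ 3 ![a 1 * a 2, a 3, a 0]; rw [sahiE_three_swap12 μ (a 1 * a 2) (a 0) (a 3)]; exact h.p3_12),
   (by show 0 ≤ sahiE μ 3 ![a 3 * a 0, a 1, a 2]; rw [show a 3 * a 0 = a 0 * a 3 from mul_comm _ _]; exact h.p3_03),
   (by show 0 ≤ sahiE μ 3 ![a 1 * a 0, a 3, a 2]; rw [show a 1 * a 0 = a 0 * a 1 from mul_comm _ _, sahiE_three_swap12 μ (a 0 * a 1) (a 2) (a 3)]; exact h.p3_01),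
   (by show 0 ≤ sahiE μ 3 ![a 2 * a 0, a 3, a 1]; rw [show a 2 * a 0 = a 0 * a 2 from mul_comm _ _, sahiE_three_swap12 μ (a 0 * a 2) (a 1) (a 3)]; exact h.p3_02),
   (by show 0 ≤ sahiE μ 4 ![a 3, a 1, a 2, a 0]; rw [sahiE_four_swap03]; exact h.e4)⟩

omit [Preorder γ] in
/-- `H₄⁺` is invariant under relabelling the members by the transposition `(1 3)`. [this work] -/
theorem h4Plus_swap13 {μ : γ → ℝ} {a : Fin 4 → γ → ℝ} (h : H4Plus μ a) : H4Plus μ ![a 0, a 3, a 2, a 1] :=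
  ⟨(by show 0 ≤ sahiE μ 3 ![a 0, a 3, a 2]; rw [sahiE_three_swap12 μ (a 0) (a 2) (a 3)]; exact h.e3_023),
   (by show 0 ≤ sahiE μ 3 ![a 0, a 3, a 1]; rw [sahiE_three_swap12 μ (a 0) (a 1) (a 3)]; exact h.e3_013),
   (by show 0 ≤ sahiE μ 3 ![a 0, a 2, a 1]; rw [sahiE_three_swap12 μ (a 0) (a 1) (a 2)]; exact h.e3_012),
   (by show 0 ≤ sahiE μ 3 ![a 3, a 2, a 1]; rw [sahiE_three_swap01 μ (a 2) (a 3) (a 1), sahiE_three_swap12 μ (a 2) (a 1) (a 3), sahiE_three_swap01 μ (a 1) (a 2) (a 3)]; exact h.e3_123),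
   (by show 0 ≤ sahiE μ 3 ![a 0 * a 3, a 2, a 1]; rw [sahiE_three_swap12 μ (a 0 * a 3) (a 1) (a 2)]; exact h.p3_03),
   (by show 0 ≤ sahiE μ 3 ![a 0 * a 2, a 3, a 1]; rw [sahiE_three_swap12 μ (a 0 * a 2) (a 1) (a 3)]; exact h.p3_02),
   (by show 0 ≤ sahiE μ 3 ![a 3 * a 2, a 0, a 1]; rw [show a 3 * a 2 = a 2 * a 3 from mul_comm _ _]; exact h.p3_23),
   (by show 0 ≤ sahiE μ 3 ![a 0 * a 1, a 3, a 2]; rw [sahiE_three_swap12 μ (a 0 * a 1) (a 2) (a 3)]; exact h.p3_01),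
   (by show 0 ≤ sahiE μ 3 ![a 3 * a 1, a 0, a 2]; rw [show a 3 * a 1 = a 1 * a 3 from mul_comm _ _]; exact h.p3_13),
   (by show 0 ≤ sahiE μ 3 ![a 2 * a 1, a 0, a 3]; rw [show a 2 * a 1 = a 1 * a 2 from mul_comm _ _]; exact h.p3_12),
   (by show 0 ≤ sahiE μ 4 ![a 0, a 3, a 2, a 1]; rw [sahiE_four_swap13]; exact h.e4)⟩

omit [Preorder γ] in
/-- `H₄⁺` is invariant under relabelling the members by the transposition `(2 3)`. [this work] -/
theorem h4Plus_swap23 {μ : γ → ℝ} {a : Fin 4 → γ → ℝ} (h : H4Plus μ a) : H4Plus μ ![a 0, a 1, a 3, a 2] :=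
  ⟨h.e3_013,
   h.e3_012,
   (by show 0 ≤ sahiE μ 3 ![a 0, a 3, a 2]; rw [sahiE_three_swap12 μ (a 0) (a 2) (a 3)]; exact h.e3_023),
   (by show 0 ≤ sahiE μ 3 ![a 1, a 3, a 2]; rw [sahiE_three_swap12 μ (a 1) (a 2) (a 3)]; exact h.e3_123),
   (by show 0 ≤ sahiE μ 3 ![a 0 * a 1, a 3, a 2]; rw [sahiE_three_swap12 μ (a 0 * a 1) (a 2) (a 3)]; exact h.p3_01),
   h.p3_03,
   h.p3_13,
   h.p3_02,
   h.p3_12,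
   (by show 0 ≤ sahiE μ 3 ![a 3 * a 2, a 0, a 1]; rw [show a 3 * a 2 = a 2 * a 3 from mul_comm _ _]; exact h.p3_23),
   (by show 0 ≤ sahiE μ 4 ![a 0, a 1, a 3, a 2]; rw [sahiE_four_swap23]; exact h.e4)⟩

/-- **`H₄⁺` is closed under the OR with an independent block feeding at most three members** (lattice level): as `h4Plus_orThree`, with the
unfed member `m` arbitrary (`b_m = 0`; members not fed may of course also have `b_i = 0`).  Reduction to `m = 3` by relabelling
(`h4Plus_swap03/13/23`). [this work] -/
theorem h4Plus_orBlock (m : Fin 4) (μ : γ → ℝ) (ν : β → ℝ)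
    (hμ0 : ∀ t, 0 ≤ μ t) (hμ1 : ∑ t, μ t = 1) (hν0 : ∀ t, 0 ≤ ν t) (hν1 : ∑ t, ν t = 1) (hμ2 : SahiPositive μ 2) (hν3 : SahiPositive ν 3)
    (a : Fin 4 → γ → ℝ) (b : Fin 4 → β → ℝ) (ha0 : ∀ i t, 0 ≤ a i t) (ha1 : ∀ i t, a i t ≤ 1) (ham : ∀ i, Monotone (a i))
    (hb0 : ∀ i t, 0 ≤ b i t) (hb1 : ∀ i t, b i t ≤ 1) (hbm : ∀ i, Monotone (b i)) (hbzm : ∀ t, b m t = 0)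
    (h : H4Plus μ a) :
    H4Plus (fun p : γ × β => μ p.1 * ν p.2) (fun (i : Fin 4) (p : γ × β) => a i p.1 + b i p.2 - a i p.1 * b i p.2) := by
  fin_cases m
  · have h1 := h4Plus_orThree μ ν hμ0 hμ1 hν0 hν1 hμ2 hν3 ![a 3, a 1, a 2, a 0] ![b 3, b 1, b 2, b 0]
      (fun i t => by fin_cases i <;> exact ha0 _ t) (fun i t => by fin_cases i <;> exact ha1 _ t) (fun i => by fin_cases i <;> exact ham _)
      (fun i t => by fin_cases i <;> exact hb0 _ t) (fun i t => by fin_cases i <;> exact hb1 _ t) (fun i => by fin_cases i <;> exact hbm _)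
      (by intro t; exact hbzm t) (h4Plus_swap03 h)
    have h2 := h4Plus_swap03 h1
    have e : (![(fun (i : Fin 4) (p : γ × β) => (![a 3, a 1, a 2, a 0] : Fin 4 → γ → ℝ) i p.1 + (![b 3, b 1, b 2, b 0] : Fin 4 → β → ℝ) i p.2 - (![a 3, a 1, a 2, a 0] : Fin 4 → γ → ℝ) i p.1 * (![b 3, b 1, b 2, b 0] : Fin 4 → β → ℝ) i p.2) 3, (fun (i : Fin 4) (p : γ × β) => (![a 3, a 1, a 2, a 0] : Fin 4 → γ → ℝ) i p.1 + (![b 3, b 1, b 2, b 0] : Fin 4 → β → ℝ) i p.2 - (![a 3, a 1, a 2, a 0] : Fin 4 → γ → ℝ) i p.1 * (![b 3, b 1, b 2, b 0] : Fin 4 → β → ℝ) i p.2) 1, (fun (i : Fin 4) (p : γ × β) => (![a 3, a 1, a 2, a 0] : Fin 4 → γ → ℝ) i p.1 + (![b 3, b 1, b 2, b 0] : Fin 4 → β → ℝ) i p.2 - (![a 3, a 1, a 2, a 0] : Fin 4 → γ → ℝ) i p.1 * (![b 3, b 1, b 2, b 0] : Fin 4 → β → ℝ) i p.2) 2, (fun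 (i : Fin 4) (p : γ × β) => (![a 3, a 1, a 2, a 0] : Fin 4 → γ → ℝ) i p.1 + (![b 3, b 1, b 2, b 0] : Fin 4 → β → ℝ) i p.2 - (![a 3, a 1, a 2, a 0] : Fin 4 → γ → ℝ) i p.1 * (![b 3, b 1, b 2, b 0] : Fin 4 → β → ℝ) i p.2) 0] : Fin 4 → γ × β → ℝ) = (fun (i : Fin 4) (p : γ × β) => a i p.1 + b i p.2 - a i p.1 * b i p.2) := by
      funext i p; fin_cases i <;> rfl
    rw [e] at h2; exact h2
  · have h1 := h4Plus_orThree μ ν hμ0 hμ1 hν0 hν1 hμ2 hν3 ![a 0, a 3, a 2, a 1] ![b 0, b 3, b 2, b 1]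
      (fun i t => by fin_cases i <;> exact ha0 _ t) (fun i t => by fin_cases i <;> exact ha1 _ t) (fun i => by fin_cases i <;> exact ham _)
      (fun i t => by fin_cases i <;> exact hb0 _ t) (fun i t => by fin_cases i <;> exact hb1 _ t) (fun i => by fin_cases i <;> exact hbm _)
      (by intro t; exact hbzm t) (h4Plus_swap13 h)
    have h2 := h4Plus_swap13 h1
    have e : (![(fun (i : Fin 4) (p : γ × β) => (![a 0, a 3, a 2, a 1] : Fin 4 → γ → ℝ) i p.1 + (![b 0, b 3, b 2, b 1] : Fin 4 → β → ℝ) i p.2 - (![a 0, a 3, a 2, a 1] : Fin 4 → γ → ℝ) i p.1 * (![b 0, b 3, b 2, b 1] : Fin 4 → β → ℝ) i p.2) 0, (fun (i : Fin 4) (p : γ × β) => (![a 0, a 3, a 2, a 1] : Fin 4 → γ → ℝ) i p.1 + (![b 0, b 3, b 2, b 1] : Fin 4 → β → ℝ) i p.2 - (![a 0, a 3, a 2, a 1] : Fin 4 → γ → ℝ) i p.1 * (![b 0, b 3, b 2, b 1] : Fin 4 → β → ℝ) i p.2) 3, (fun (i : Fin 4) (p : γ × β) => (![a 0, a 3, a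 2, a 1] : Fin 4 → γ → ℝ) i p.1 + (![b 0, b 3, b 2, b 1] : Fin 4 → β → ℝ) i p.2 - (![a 0, a 3, a 2, a 1] : Fin 4 → γ → ℝ) i p.1 * (![b 0, b 3, b 2, b 1] : Fin 4 → β → ℝ) i p.2) 2, (fun (i : Fin 4) (p : γ × β) => (![a 0, a 3, a 2, a 1] : Fin 4 → γ → ℝ) i p.1 + (![b 0, b 3, b 2, b 1] : Fin 4 → β → ℝ) i p.2 - (![a 0, a 3, a 2, a 1] : Fin 4 → γ → ℝ) i p.1 * (![b 0, b 3, b 2, b 1] : Fin 4 → β → ℝ) i p.2) 1] : Fin 4 → γ × β → ℝ) = (fun (i : Fin 4) (p : γ × β) => a i p.1 + b i p.2 - a i p.1 * b i p.2) := by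
      funext i p; fin_cases i <;> rfl
    rw [e] at h2; exact h2
  · have h1 := h4Plus_orThree μ ν hμ0 hμ1 hν0 hν1 hμ2 hν3 ![a 0, a 1, a 3, a 2] ![b 0, b 1, b 3, b 2]
      (fun i t => by fin_cases i <;> exact ha0 _ t) (fun i t => by fin_cases i <;> exact ha1 _ t) (fun i => by fin_cases i <;> exact ham _)
      (fun i t => by fin_cases i <;> exact hb0 _ t) (fun i t => by fin_cases i <;> exact hb1 _ t) (fun i => by fin_cases i <;> exact hbm _)
      (by intro t; exact hbzm t) (h4Plus_swap23 h)
    have h2 := h4Plus_swap23 h1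
    have e : (![(fun (i : Fin 4) (p : γ × β) => (![a 0, a 1, a 3, a 2] : Fin 4 → γ → ℝ) i p.1 + (![b 0, b 1, b 3, b 2] : Fin 4 → β → ℝ) i p.2 - (![a 0, a 1, a 3, a 2] : Fin 4 → γ → ℝ) i p.1 * (![b 0, b 1, b 3, b 2] : Fin 4 → β → ℝ) i p.2) 0, (fun (i : Fin 4) (p : γ × β) => (![a 0, a 1, a 3, a 2] : Fin 4 → γ → ℝ) i p.1 + (![b 0, b 1, b 3, b 2] : Fin 4 → β → ℝ) i p.2 - (![a 0, a 1, a 3, a 2] : Fin 4 → γ → ℝ) i p.1 * (![b 0, b 1, b 3, b 2] : Fin 4 → β → ℝ) i p.2) 1, (fun (i : Fin 4) (p : γ × β) => (![a 0, a 1, a 3, a 2] : Fin 4 → γ → ℝ) i p.1 + (![b 0, b 1, b 3, b 2] : Fin 4 → β → ℝ) i p.2 - (![a 0, a 1, a 3, a 2] : Fin 4 → γ → ℝ) i p.1 * (![b 0, b 1, b 3, b 2] : Fin 4 → β → ℝ) i p.2) 3, (fun (i : Fin 4) (p : γ × β) => (![a 0, a 1, a 3, a 2] : Fin 4 → γ →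 ℝ) i p.1 + (![b 0, b 1, b 3, b 2] : Fin 4 → β → ℝ) i p.2 - (![a 0, a 1, a 3, a 2] : Fin 4 → γ → ℝ) i p.1 * (![b 0, b 1, b 3, b 2] : Fin 4 → β → ℝ) i p.2) 2] : Fin 4 → γ × β → ℝ) = (fun (i : Fin 4) (p : γ × β) => a i p.1 + b i p.2 - a i p.1 * b i p.2) := by
      funext i p; fin_cases i <;> rfl
    rw [e] at h2; exact h2
  · exact h4Plus_orThree μ ν hμ0 hμ1 hν0 hν1 hμ2 hν3 a b ha0 ha1 ham hb0 hb1 hbm hbzm h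

end Summit.CriticalPhenomena.PercolationContinuityZ3.Theorems.SahiH4Plus

end
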